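import Summits.KontsevichZagierPeriods.KontsevichZagierPeriods.Theorems.HurwitzMicroSectorsNormalFormPrinciplePiPowersKernelEta

/-!
# `NormalFormPrinciple` (stmt-KontsevichZagierPeriods-3869), line `SketchIdeator1` —
# leaf `stub_boxRigidity`: the `π`-powers kernel in the vocabulary of the leaf (pairs)

Pure proof file (lead seat c9; `--supports` the crux). The leaf `stub_boxRigidity` speaks of PAIRS:
two rational box representations with equal values are KZ-equivalent. On the generators of the
`π`-powers kernel (`piPowersEta_mem_relations_of_eval_eq_zero`: the even zeta layer, the rational
polynomial boxes, the level-one boxes of dimension two, the dilogarithm boxes, the eight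
`ζ(4)`-valued level-two families of dimension four) this holds UNCONDITIONALLY and across
dimensions: `[N] − [N']` lies in the kernel subgroup and has value `0`.
References: M. Kontsevich, D. Zagier, *Periods* (2001), §1.2 (Conjecture 1). No definitions are introduced.
-/

noncomputable section

open MeasureTheory Set
open Literature.NumberTheory.Transcendental Literature.NumberTheory.Transcendental.KZ

namespace Summit.KontsevichZagierPeriods.HurwitzMicroSectors.NormalFormPrinciple.PiBox.M3

/-- **Equal values imply KZ-equivalence, unconditionally, for any two generators of the
`π`-powers kernel** (possibly of different dimensions; lead seat c9, line `SketchIdeator1`).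
[cite: KontsevichZagier2001, §1.2 Conjecture 1] -/
theorem piPowers_equivalent_of_value_eq {n m : ℕ} (N : IntegralRep n) (N' : IntegralRep m)
    (hN : of N ∈ (({y : FormalRep | ∃ (k : ℕ) (S : Finset ℕ) (coef : ℕ → ℝ) (N : IntegralRep (2 * (k + 1))),
          (∀ i ∈ S, IsAlgebraic ℚ (coef i)) ∧ N.domain = {x | ∀ i, x i ∈ Set.Ioo (0:ℝ) 1} ∧
          EqOn N.integrand (fun x => (∑ i ∈ S, coef i * (∏ l, x l) ^ i) / (1 - ∏ l, x l)) N.domain ∧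
          y = of N} ∪
       {y : FormalRep | ∃ (w : ℕ) (c : ℝ) (N : IntegralRep w), IsAlgebraic ℚ c ∧
          N.domain = {x | ∀ i, x i ∈ Set.Ioo (0:ℝ) 1} ∧ EqOn N.integrand (fun _ => c) N.domain ∧ y = of N} ∪
       {y : FormalRep | ∃ (r : ℝ) (Z : IntegralRep 0), IsAlgebraic ℚ r ∧ Z.domain = Set.univ ∧
          (Z.integrand = fun _ => r) ∧ y = of Z} ∪
       {y : FormalRep | ∃ (m : ℕ) (p : MvPolynomial (Fin m) ℚ) (N : IntegralRep m),
          N.domain = {x | ∀ i, x i ∈ Set.Ioo (0:ℝ) 1} ∧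
          EqOn N.integrand (fun x => (MvPolynomial.aeval x p : ℝ)) N.domain ∧ y = of N} ∪
       {y : FormalRep | ∃ (P : MvPolynomial (Fin 2) ℚ) (N : IntegralRep 2),
          N.domain = {x | ∀ i, x i ∈ Set.Ioo (0:ℝ) 1} ∧
          EqOn N.integrand (fun x => (MvPolynomial.aeval x P : ℝ) / (1 - x 0 * x 1)) N.domain ∧
          y = of N} ∪
       {y : FormalRep | ∃ N : IntegralRep 2, N.domain = {x | ∀ i, x i ∈ Set.Ioo (0:ℝ) 1} ∧
          EqOn N.integrand (fun x => 1 / (1 + x 0 * x 1)) N.domain ∧ y = of N} ∪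
       {y : FormalRep | ∃ N : IntegralRep 2, N.domain = {x | ∀ i, x i ∈ Set.Ioo (0:ℝ) 1} ∧
          EqOn N.integrand (fun x => 4 * x 0 * x 1 / (1 - x 0 ^ 2 * x 1 ^ 2)) N.domain ∧ y = of N} ∪
       {y : FormalRep | ∃ N : IntegralRep 2, N.domain = {x | ∀ i, x i ∈ Set.Ioo (0:ℝ) 1} ∧
          EqOn N.integrand (fun x => 1 / (-1 - x 0 * x 1)) N.domain ∧ y = of N} ∪
       {y : FormalRep | ∃ N : IntegralRep 4, N.domain = {x | ∀ i, x i ∈ Set.Ioo (0:ℝ) 1} ∧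
          EqOn N.integrand (fun x => 1 / (1 - x 0 * x 1 * x 2 * x 3)) N.domain ∧ y = of N} ∪
       {y : FormalRep | ∃ N : IntegralRep 4, N.domain = {x | ∀ i, x i ∈ Set.Ioo (0:ℝ) 1} ∧
          EqOn N.integrand (fun x => 1 / (1 + x 0 * x 1 * x 2 * x 3)) N.domain ∧ y = of N} ∪
       {y : FormalRep | ∃ N : IntegralRep 4, N.domain = {x | ∀ i, x i ∈ Set.Ioo (0:ℝ) 1} ∧
          EqOn N.integrand (fun x => 1 / ((1 - x 0 * x 1) * (1 - x 0 * x 1 * x 2 * x 3))) N.domain ∧ y = of N} ∪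
       {y : FormalRep | ∃ N : IntegralRep 4, N.domain = {x | ∀ i, x i ∈ Set.Ioo (0:ℝ) 1} ∧
          EqOn N.integrand (fun x => 1 / ((1 - x 0 * x 1 * x 2) * (1 - x 0 * x 1 * x 2 * x 3))) N.domain ∧ y = of N} ∪
       {y : FormalRep | ∃ N : IntegralRep 4, N.domain = {x | ∀ i, x i ∈ Set.Ioo (0:ℝ) 1} ∧
          EqOn N.integrand (fun x => 1 / ((1 - x 0 * x 1) * (1 - x 2 * x 3))) N.domain ∧ y = of N} ∪
       {y : FormalRep | ∃ N : IntegralRep 4, N.domain = {x | ∀ i, x i ∈ Set.Ioo (0:ℝ) 1} ∧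
          EqOn N.integrand (fun x => 1 / ((1 - x 0 * x 1) * (1 + x 2 * x 3))) N.domain ∧ y = of N} ∪
       {y : FormalRep | ∃ N : IntegralRep 4, N.domain = {x | ∀ i, x i ∈ Set.Ioo (0:ℝ) 1} ∧
          EqOn N.integrand (fun x => 1 / ((1 + x 0 * x 1) * (1 + x 2 * x 3))) N.domain ∧ y = of N}) ∪
       {y : FormalRep | ∃ N : IntegralRep 4, N.domain = {x | ∀ i, x i ∈ Set.Ioo (0:ℝ) 1} ∧
          EqOn N.integrand (fun x => 1 / ((1 + x 0 * x 1) * (1 - x 0 * x 1 * x 2 * x 3))) N.domain ∧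
          y = of N}))
    (hN' : of N' ∈ (({y : FormalRep | ∃ (k : ℕ) (S : Finset ℕ) (coef : ℕ → ℝ) (N : IntegralRep (2 * (k + 1))),
          (∀ i ∈ S, IsAlgebraic ℚ (coef i)) ∧ N.domain = {x | ∀ i, x i ∈ Set.Ioo (0:ℝ) 1} ∧
          EqOn N.integrand (fun x => (∑ i ∈ S, coef i * (∏ l, x l) ^ i) / (1 - ∏ l, x l)) N.domain ∧
          y = of N} ∪
       {y : FormalRep | ∃ (w : ℕ) (c : ℝ) (N : IntegralRep w), IsAlgebraic ℚ c ∧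
          N.domain = {x | ∀ i, x i ∈ Set.Ioo (0:ℝ) 1} ∧ EqOn N.integrand (fun _ => c) N.domain ∧ y = of N} ∪
       {y : FormalRep | ∃ (r : ℝ) (Z : IntegralRep 0), IsAlgebraic ℚ r ∧ Z.domain = Set.univ ∧
          (Z.integrand = fun _ => r) ∧ y = of Z} ∪
       {y : FormalRep | ∃ (m : ℕ) (p : MvPolynomial (Fin m) ℚ) (N : IntegralRep m),
          N.domain = {x | ∀ i, x i ∈ Set.Ioo (0:ℝ) 1} ∧
          EqOn N.integrand (fun x => (MvPolynomial.aeval x p : ℝ)) N.domain ∧ y = of N} ∪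
       {y : FormalRep | ∃ (P : MvPolynomial (Fin 2) ℚ) (N : IntegralRep 2),
          N.domain = {x | ∀ i, x i ∈ Set.Ioo (0:ℝ) 1} ∧
          EqOn N.integrand (fun x => (MvPolynomial.aeval x P : ℝ) / (1 - x 0 * x 1)) N.domain ∧
          y = of N} ∪
       {y : FormalRep | ∃ N : IntegralRep 2, N.domain = {x | ∀ i, x i ∈ Set.Ioo (0:ℝ) 1} ∧
          EqOn N.integrand (fun x => 1 / (1 + x 0 * x 1)) N.domain ∧ y = of N} ∪
       {y : FormalRep | ∃ N : IntegralRep 2, N.domain = {x | ∀ i, x i ∈ Set.Ioo (0:ℝ) 1} ∧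
          EqOn N.integrand (fun x => 4 * x 0 * x 1 / (1 - x 0 ^ 2 * x 1 ^ 2)) N.domain ∧ y = of N} ∪
       {y : FormalRep | ∃ N : IntegralRep 2, N.domain = {x | ∀ i, x i ∈ Set.Ioo (0:ℝ) 1} ∧
          EqOn N.integrand (fun x => 1 / (-1 - x 0 * x 1)) N.domain ∧ y = of N} ∪
       {y : FormalRep | ∃ N : IntegralRep 4, N.domain = {x | ∀ i, x i ∈ Set.Ioo (0:ℝ) 1} ∧
          EqOn N.integrand (fun x => 1 / (1 - x 0 * x 1 * x 2 * x 3)) N.domain ∧ y = of N} ∪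
       {y : FormalRep | ∃ N : IntegralRep 4, N.domain = {x | ∀ i, x i ∈ Set.Ioo (0:ℝ) 1} ∧
          EqOn N.integrand (fun x => 1 / (1 + x 0 * x 1 * x 2 * x 3)) N.domain ∧ y = of N} ∪
       {y : FormalRep | ∃ N : IntegralRep 4, N.domain = {x | ∀ i, x i ∈ Set.Ioo (0:ℝ) 1} ∧
          EqOn N.integrand (fun x => 1 / ((1 - x 0 * x 1) * (1 - x 0 * x 1 * x 2 * x 3))) N.domain ∧ y = of N} ∪
       {y : FormalRep | ∃ N : IntegralRep 4, N.domain = {x | ∀ i, x i ∈ Set.Ioo (0:ℝ) 1} ∧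
          EqOn N.integrand (fun x => 1 / ((1 - x 0 * x 1 * x 2) * (1 - x 0 * x 1 * x 2 * x 3))) N.domain ∧ y = of N} ∪
       {y : FormalRep | ∃ N : IntegralRep 4, N.domain = {x | ∀ i, x i ∈ Set.Ioo (0:ℝ) 1} ∧
          EqOn N.integrand (fun x => 1 / ((1 - x 0 * x 1) * (1 - x 2 * x 3))) N.domain ∧ y = of N} ∪
       {y : FormalRep | ∃ N : IntegralRep 4, N.domain = {x | ∀ i, x i ∈ Set.Ioo (0:ℝ) 1} ∧
          EqOn N.integrand (fun x => 1 / ((1 - x 0 * x 1) * (1 + x 2 * x 3))) N.domain ∧ y = of N} ∪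
       {y : FormalRep | ∃ N : IntegralRep 4, N.domain = {x | ∀ i, x i ∈ Set.Ioo (0:ℝ) 1} ∧
          EqOn N.integrand (fun x => 1 / ((1 + x 0 * x 1) * (1 + x 2 * x 3))) N.domain ∧ y = of N}) ∪
       {y : FormalRep | ∃ N : IntegralRep 4, N.domain = {x | ∀ i, x i ∈ Set.Ioo (0:ℝ) 1} ∧
          EqOn N.integrand (fun x => 1 / ((1 + x 0 * x 1) * (1 - x 0 * x 1 * x 2 * x 3))) N.domain ∧
          y = of N}))
    (hval : N.value = N'.value) : Equivalent N N' := by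
  refine piPowersEta_mem_relations_of_eval_eq_zero (AddSubgroup.sub_mem _
    (AddSubgroup.subset_closure hN) (AddSubgroup.subset_closure hN')) ?_
  rw [map_sub, eval_of, eval_of, hval, sub_self]

/-- **Example across levels** (registered entry): a level-two dilogarithm box `[□², ≡ 1/(1+xy)]` and a
level-two box of dimension four `[□⁴, ≡ 1/((1+x₀x₁)(1−Π))]` — two generators of the `π`-powers
kernel of different dimensions — are KZ-equivalent as soon as their values agree (they do not:
`π²/12 ≠ 13π⁴/1440`, so the content is the kernel statement itself; the point is that NO hypothesis
is needed). [cite: KontsevichZagier2001, §1.2 Conjecture 1] -/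
theorem piPowers_pair_example (N : IntegralRep 2) (N' : IntegralRep 4)
    (hNd : N.domain = {x | ∀ i, x i ∈ Set.Ioo (0:ℝ) 1})
    (hNi : EqOn N.integrand (fun x => 1 / (1 + x 0 * x 1)) N.domain)
    (hN'd : N'.domain = {x | ∀ i, x i ∈ Set.Ioo (0:ℝ) 1})
    (hN'i : EqOn N'.integrand (fun x => 1 / ((1 + x 0 * x 1) * (1 - x 0 * x 1 * x 2 * x 3))) N'.domain)
    (hval : N.value = N'.value) : Equivalent N N' :=
  piPowers_equivalent_of_value_eq N N'
    (Or.inl (Or.inl (Or.inl (Or.inl (Or.inl (Or.inl (Or.inl (Or.inl (Or.inl (Or.inl (Or.inr ⟨N, hNd, hNi, rfl⟩)))))))))))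
    (Or.inr ⟨N', hN'd, hN'i, rfl⟩) hval

end Summit.KontsevichZagierPeriods.HurwitzMicroSectors.NormalFormPrinciple.PiBox.M3
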